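import Literature.MathematicalPhysics.QuantumFieldTheory.Balaban1983to89.B9Eq3132KinvPiSubKinvLetterTower

/-!
# `Balaban1983to89.B9Eq3133H1kPiSubH1kLetterTower` — T. Bałaban, *Propagators for lattice gauge theories in a background field*, Commun. Math. Phys. **99** (1985) 389–434
# [Balaban1985BackgroundPropagators] (3.126) p. 420 *«HB = GQ*(QGQ*)⁻¹B»*, (3.131)–(3.133) p. 422 (*«… Thus we have Theorem 3.3 for G … The above inequality together with Theorem 3.3
# for G … give (3.133)»*), (3.130) p. 421, (3.117) p. 419, Thm 3.11 p. 416, with [Balaban1985Variational] (45) p. 285: **THE SLOT DIFFERENCE OF THE MINIMIZERS —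
# `H̃_k(U) − H_k(U)`, `H̃_k = G̃_kQ_k†K̃_k⁻¹` at PRINT's operator (3.122), `H_k = G₁,kQ_k†K_k⁻¹` at the chain's (3.26), AT THE SAME BACKGROUND, AS A LOCAL LETTER WITH THE SMALL
# FACTOR `j₀`, CONSTANTS BEFORE `n, η, m, U`**: `‖((H̃_k − H_k)z)(b)‖ ≤ j₀·K·e^{−κ·d_m(Π(b₋), v)}·F` — `H̃ − H = (G̃ − G)Q†K̃⁻¹ + GQ†(K̃⁻¹ − K⁻¹)`; with `B9Eq3119DeltaPiTowerFlat`
# (`H̃_k(1) = H_k(1)`) and gen 101's `B9Eq3126H1kTwoBackgroundLetterTower` this is the value member of the π two-background ladder `H̃_k(U) − H̃_k(1) = (H̃_k(U) − H_k(U)) +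
# (H_k(U) − H_k(1))` of the chart actually instantiated by the `Support/NE9CurChartTowerPi…` leaves

statement-level skeleton of published theorems with citation tags; proofs where landed; nothing here is a claim about the Yang–Mills mass gap

CITATION HEADER (lean-in-tree rule).  Audit cell `pub-balaban`, sub-cell `t4`, BINDER row NE9; filed by NE9 crux-team LEAF PROVER 01 (`b2b-balaban-t4-ne9-formalise-leaf-01`, gen 101;
ROUTE (J′), π-side; bears_on: R4/N22).  Composition BY NAME: this lineage's `B9Eq3132KinvPiSubKinvLetterTower.exists_letter_KinvPi_sub_Kinv` (gen 101); ne9-leaf-05's (K79)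
`B9Eq3130GtildeMinusG1kRowsClosed.exists_local_letters_G1LatticeKPi_sub_G1k`, (K80) `B9Eq3132QGtildeQInvLetterClosed.exists_local_letter_KinvLatticeKPi`, (K64)
`B9Eq326G1kSupRowClosed.exists_local_letter_G1k` (the MODEL row of `G₁,k` — O-NE9-1, #5 UNRULED), `B9Eq326G1SupRowOfLetters.{letter_comp, letter_add}`; ne9-leaf-03's
`B9Eq315QkSingleBondLetter.norm_adjoint_QkW_apply_le_local_sharp`; `B11Eq103H1Complex.H1LatticeK` (`= G₁∘Q†∘K⁻¹`, `rfl`).  Source READ first-hand in the held text layer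
`paper:balaban1985-cmp99-background-propagators` (journal page = PDF page + 388) pp. 419–422.  NOTHING of print's proofs is reproduced: [folklore] telescoping + letter compositions.

WHAT IS PROVED (sorry-free; proof lane — 0 `def`; [folklore]).
* **`exists_letter_H1kPi_sub_H1k`** — `∃ α₁ j₁ > 0, K ≥ 0, κ > 0` BEFORE (K80)'s binder block VERBATIM: for every coarse-bond field `z` supported over `bpos⁻¹(v)` with `‖z(c′)‖ ≤ F`
  and every fine bond `b`: `‖(H̃_kz − H_kz)(b)‖ ≤ j₀·K·e^{−κ·d_m(Π(b₋),v)}·F`, `H̃_k = H1LatticeK hposπ hQ`, `H_k = H1LatticeK hpos hQ` (two words, two `letter_comp` each, `letter_add`).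
HONEST SCOPE.  Composition BY NAME on the cell's MODEL rows (O-NE9-1, #5 UNRULED); constants crude (NOT print's `B₀` of (3.133)); ONE background; VALUE member only (the gradient member needs
the gradient row of `G̃_k − G₁,k`, not in the tree); the current window `‖J‖ ≤ j₀ ≤ j₁`, `c₀ = η^d`, the other windows, unitarity, the tower data, `hαL`, the positivity and onto witnesses
stay HYPOTHESES; nothing of [B9] (3.130)–(3.133) asserted as printed; «NE9 ⇐ the named binders»; NE9 NOT PRINTED ∕ NOT PROVED; spine PROVED 0∕9; rung (B)+1 on a finite T⁴ — NOT infinite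
volume, NOT mass gap, NOT BetaPertH, NOT Clay.  HONEST DEPENDENCY: continuum YM on T⁴ ⇐ BetaPertH ∧ nine spine estimates (0/9 proved); BetaPertH ⇐ (D1) ∧ (D4) ∧ CAP+tail; G-an2-4
gates asym, D1 and NE2/3/4.  NEW file; nothing modified.  Net new unproved facts: 0.
-/

noncomputable section

open scoped InnerProductSpace ComplexConjugate BigOperators

namespace Literature.MathematicalPhysics.QuantumFieldTheory.Balaban1983to89.B9Eq3133H1kPiSubH1kLetterTower

open B4Sect5Torus (TSite tdist tdist_nonneg tdist_triangle tdist_symm torusSum_le tdist_self)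
open B4Sect5Proof (latticeConst latticeConst_nonneg)
open B9SectCLatticeCarrier (Bond bpos shift unshift)
open B9Eq311L2Pairing (WL2)
open B9Eq319QprimeTorus (blockCoord)
open B7Prop1Explicit (U1 Wcx boxVec)
open B11Eq103H1Complex (SiteL2K BondL2K G1LatticeK KinvLatticeK H1LatticeK)
open B9Eq310DeltaPrime (plaqHolU)
open B9Eq310HessianOperator (adTransportW)
open B9Eq315QTorus (perCfg cornerSite)
open B9Eq315QTower (towerP UlevOf)
open B9Eq316TowerFlatIsOneStep (towerP_eq_fineP_pow siteCast)
open B9Eq326OperatorTower (QkW laplaceAk G1k)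
open B9Eq324DeltaPrimeATower (laplacePrimeAk)
open B9Eq3119DeltaPiTower (laplaceAkPi)
open B9Eq349BlockDistanceWeight (tdist_shift_le_one)
open B9Eq315QkSingleBondLetter (norm_adjoint_QkW_apply_le_local_sharp)
open B9Eq326G1SupRowOfLetters (letter_comp letter_add)
open B9Eq326G1kSupRowClosed (exists_local_letter_G1k)
open B9Eq3130GtildeMinusG1kRowsClosed (exists_local_letters_G1LatticeKPi_sub_G1k)
open B9Eq3132QGtildeQInvLetterClosed (exists_local_letter_KinvLatticeKPi)
open B9Eq3132KinvPiSubKinvLetterTower (exists_letter_KinvPi_sub_Kinv)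

variable {d : ℕ} (hd : 1 ≤ d) (L : ℕ) [NeZero L] (hL : 1 ≤ L) (hL3 : 3 ≤ L)
  {𝔸 : Type*} [NormedRing 𝔸] [NormedAlgebra ℂ 𝔸] [CompleteSpace 𝔸] [NormOneClass 𝔸] [StarRing 𝔸] [NormedStarGroup 𝔸] [StarModule ℂ 𝔸]
  {W : Type*} [NormedAddCommGroup W] [InnerProductSpace ℂ W] [FiniteDimensional ℂ W] (φ : W ≃ₗ[ℂ] 𝔸)
  {Mφ Mφ' : ℝ} (hMφ : 0 ≤ Mφ) (hMφ' : 0 ≤ Mφ') (hφ : ∀ w, ‖φ w‖ ≤ Mφ * ‖w‖) (hφ' : ∀ X, ‖φ.symm X‖ ≤ Mφ' * ‖X‖) (hstar : ∀ X : 𝔸, ‖star X‖ ≤ ‖X‖)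
  {a : ℝ} (ha : 0 < a) {a' : ℝ} (ha' : 0 < a') {ϱ : ℝ} (hϱ0 : 0 ≤ ϱ) (hϱ1 : ϱ < 1)
  (τ : 𝔸 →ₗ[ℂ] ℂ) {Cτ : ℝ} (hτ : ∀ X, ‖τ X‖ ≤ Cτ * ‖X‖) (hCτ : 0 ≤ Cτ) {Mτ : ℝ} (hτm : ∀ X Y : 𝔸, ‖τ (X * Y)‖ ≤ Mτ * ‖X‖ * ‖Y‖) (hMτ : 0 ≤ Mτ)
  {ρw : ℝ} (hρw : 0 ≤ ρw)
  (hτ₁ : ∀ X : 𝔸, τ (star X) = conj (τ X)) (hτ₂ : ∀ X Y : 𝔸, τ (X * Y) = τ (Y * X)) (hφτ : ∀ X Y : 𝔸, ⟪φ.symm X, φ.symm Y⟫_ℂ = τ (star X * Y))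
  (AQ : ℝ)

include hd hL hL3 hMφ hMφ' hφ hφ' hstar ha ha' hϱ0 hϱ1 hτ hCτ hτm hMτ hρw hτ₁ hτ₂ hφτ in
set_option maxHeartbeats 3200000 in
set_option maxRecDepth 8192 in
/-- **THE SLOT DIFFERENCE `H̃_k(U) − H_k(U)` AS A LOCAL LETTER WITH THE FACTOR `j₀`** — see the module docstring. [folklore]
[cite: Balaban1985BackgroundPropagators, (3.126) p.420, (3.131)–(3.133) p.422, (3.130) p.421, (3.117) p.419, Thm 3.11 p.416; Balaban1985Variational, (45) p.285] -/
theorem exists_letter_H1kPi_sub_H1k :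
    ∃ α₁ j₁ K κ : ℝ, 0 < α₁ ∧ 0 < j₁ ∧ 0 ≤ K ∧ 0 < κ ∧
      ∀ (n : ℕ) (η : ℝ) (_hηL : η * (L : ℝ) ^ (n + 1) = 1) (c₀ c₁ : ℝ) [Fact (0 < c₀)] [Fact (0 < c₁)]
        (_hw : c₀ * ((L : ℝ) ^ (n + 1)) ^ d = c₁) (_hρ : |η| ^ d / c₀ ≤ ρw) (m : Fin d → ℕ) [∀ i, NeZero (m i)] (_hm : ∀ i, 1 ≤ m i)
        (U : Bond d (towerP L m (n + 1)) → 𝔸ˣ) (αU : ℕ → ℝ) (_hα0 : ∀ j, 0 ≤ αU j) (hα1 : ∀ j, αU j ≤ 1 / 64)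
        (hαL : ∀ j, 50 * (d + 1) * αU j * (L : ℝ) ^ d ≤ 1 / 2)
        (hU1 : ∀ (j : ℕ) (x : B7Prop1Explicit.Site d) (k : Fin d), perCfg (towerP L m (j + 1)) (UlevOf L m (n + 1) U j) x k ∈ U1 𝔸)
        (hreg : ∀ (j : ℕ) (y : TSite d (towerP L m j)) (k : Fin d) (ρ' : Fin d → Fin L),
          ‖((Wcx L (perCfg (towerP L m (j + 1)) (UlevOf L m (n + 1) U j)) (cornerSite L y) k (boxVec L ρ') : 𝔸ˣ) : 𝔸) - 1‖ ≤ αU j)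
        (εU : ℕ → ℝ) (_hεU : ∀ j, 0 ≤ εU j) (_hUε : ∀ (j : ℕ) (b : Bond d (towerP L m (j + 1))), ‖(UlevOf L m (n + 1) U j b : 𝔸) - 1‖ ≤ εU j)
        (_hLb : ∀ (j : ℕ) (b : Bond d (towerP L m (j + 1))), UlevOf L m (n + 1) U j b ∈ U1 𝔸)
        (α : ℝ) (_hα : 0 ≤ α) (_hαle : α ≤ α₁)
        (hUst : ∀ b, star (U b : 𝔸) = (((U b)⁻¹ : 𝔸ˣ) : 𝔸)) (_hUb : ∀ b, U b ∈ U1 𝔸) (_hUη : ∀ b, ‖(U b : 𝔸) - 1‖ ≤ α * η)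
        (_hpl : ∀ p : B9SectCLatticeCarrier.Plaq d (towerP L m (n + 1)), ‖(plaqHolU U p : 𝔸) - 1‖ ≤ α * η ^ 2)
        (_hUgrad : ∀ (x : TSite d (towerP L m (n + 1))) (μ : Fin d), ‖(U (x, μ) : 𝔸) - U (unshift μ x, μ)‖ ≤ α * η ^ 2)
        (_hRlev : ∀ (j : ℕ) (b : Bond d (towerP L m (j + 1))) (w : W), ‖adTransportW φ (UlevOf L m (n + 1) U j) b w‖ ≤ ‖w‖)
        (_hεg : ∀ j < n + 1, εU j ≤ α * ϱ ^ j) (_hAQ : ∑ j ∈ Finset.range (n + 1), αU j ≤ AQ)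
        (hpos' : ∀ x : SiteL2K ℂ d (towerP L m (n + 1)) c₀ W, x ≠ 0 → 0 < RCLike.re ⟪x, laplacePrimeAk L m n φ η U a' (c₁ := c₁) x⟫_ℂ)
        (hpos : ∀ x : BondL2K ℂ d (towerP L m (n + 1)) c₀ W, x ≠ 0 →
          0 < RCLike.re ⟪x, laplaceAk L m n φ η U hL αU hα1 hU1 hreg τ (c₀ := c₀) (c₁ := c₁) a x⟫_ℂ)
        (_hc₀η : c₀ = η ^ d) (j₀ : ℝ) (_hJ : ∀ μ y, ‖B9Eq39Adjoint.J (fun μ => B9Eq33CovDerivVector.shiftEquiv μ) (fun μ y => U (y, μ)) η μ y‖ ≤ j₀) (_hj : j₀ ≤ j₁)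
        (hposπ : ∀ x : BondL2K ℂ d (towerP L m (n + 1)) c₀ W, x ≠ 0 →
          0 < RCLike.re ⟪x, laplaceAkPi L m n φ τ η U a' hpos' hL αU hα1 hU1 hreg (c₁ := c₁) a x⟫_ℂ)
        (hQ : Function.Surjective (QkW L m n φ U hL αU hα1 hU1 hreg (c₀ := c₀) (c₁ := c₁)))
        (v : TSite d m) (z : BondL2K ℂ d m c₁ W) (F : ℝ)
        (_hzv : ∀ c', bpos c' ≠ v → WL2.equiv ℂ (fun _ : Bond d m => c₁) W z c' = 0)
        (_hzF : ∀ c', ‖WL2.equiv ℂ (fun _ : Bond d m => c₁) W z c'‖ ≤ F) (bd : Bond d (towerP L m (n + 1))),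
        ‖WL2.equiv ℂ (fun _ : Bond d (towerP L m (n + 1)) => c₀) W (H1LatticeK hposπ hQ z - H1LatticeK hpos hQ z) bd‖ ≤
          j₀ * K * Real.exp (-(κ * tdist m (blockCoord (L ^ (n + 1)) m (siteCast (towerP_eq_fineP_pow L m (n + 1)) (bpos bd))) v)) * F := by
  classical
  -- (0) the suppliers, `∃`-first
  obtain ⟨αD, jD, CD, δD, hαD, hjD, hCD, hδD, HD⟩ :=
    exists_local_letters_G1LatticeKPi_sub_G1k hd L hL hL3 φ hMφ hMφ' hφ hφ' hstar ha ha' hϱ0 hϱ1 τ hτ hCτ hτm hMτ hρw hτ₁ hτ₂ hφτ AQ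
  obtain ⟨αP, jP, BP, δP, hαP, hjP, hBP, hδP, HP⟩ :=
    exists_local_letter_KinvLatticeKPi hd L hL hL3 φ hMφ hMφ' hφ hφ' hstar ha ha' hϱ0 hϱ1 τ hτ hCτ hτm hMτ hρw hτ₁ hτ₂ hφτ AQ
  obtain ⟨αX, jX, KX, κX, hαX, hjX, hKX, hκX, HX⟩ :=
    exists_letter_KinvPi_sub_Kinv hd L hL hL3 φ hMφ hMφ' hφ hφ' hstar ha ha' hϱ0 hϱ1 τ hτ hCτ hτm hMτ hρw hτ₁ hτ₂ hφτ AQ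
  obtain ⟨αG, BG, δG, hαG, hBG, hδG, ROWU⟩ :=
    exists_local_letter_G1k hd L hL hL3 φ hMφ hMφ' hφ hφ' hstar ha ha' hϱ0 hϱ1 τ hτ hCτ hτm hMτ hρw hτ₁ hτ₂ hφτ AQ
  set κ₀ : ℝ := min (min δD δP) (min κX δG) with hκ₀
  have hκ₀0 : 0 < κ₀ := lt_min (lt_min hδD hδP) (lt_min hκX hδG)
  have hκ₀D : κ₀ ≤ δD := (min_le_left _ _).trans (min_le_left _ _)
  have hκ₀P : κ₀ ≤ δP := (min_le_left _ _).trans (min_le_right _ _)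
  have hκ₀X : κ₀ ≤ κX := (min_le_right _ _).trans (min_le_left _ _)
  have hκ₀G : κ₀ ≤ δG := (min_le_right _ _).trans (min_le_right _ _)
  set S : ℝ := latticeConst d (κ₀ / 2) with hS
  have hS0 : 0 ≤ S := latticeConst_nonneg d (half_pos hκ₀0).le
  set EA : ℝ := Real.exp (100 * d * (d + 1) * (L : ℝ) ^ d * AQ) with hEA
  set KSU : ℝ := Mφ' * Mφ * EA * ((2 * d : ℕ) : ℝ) * Real.exp κ₀ with hKSU
  have hKSU0 : 0 ≤ KSU := by positivity
  set K : ℝ := BP * KSU * S * (CD * 1) * S + (KX * 1) * KSU * S * BG * S with hK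
  have hK0 : 0 ≤ K := by positivity
  refine ⟨min (min αD αP) (min αX αG), min jD (min jP jX), K, κ₀ / 2, lt_min (lt_min hαD hαP) (lt_min hαX hαG), lt_min hjD (lt_min hjP hjX), hK0, half_pos hκ₀0, ?_⟩
  intro n η hηL c₀ c₁ _ _ hw hρ m _ hm U αU hα0 hα1 hαL hU1 hreg εU hεU hUε hLb α hα hαle hUst hUb hUη hpl hUgrad hRlev hεg hAQ hpos' hpos hc₀η j₀ hJ hj hposπ hQ
    v z F hzv hzF bd
  have hαD' : α ≤ αD := hαle.trans ((min_le_left _ _).trans (min_le_left _ _))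
  have hαP' : α ≤ αP := hαle.trans ((min_le_left _ _).trans (min_le_right _ _))
  have hαX' : α ≤ αX := hαle.trans ((min_le_right _ _).trans (min_le_left _ _))
  have hαG' : α ≤ αG := hαle.trans ((min_le_right _ _).trans (min_le_right _ _))
  have hjD' : j₀ ≤ jD := hj.trans (min_le_left _ _)
  have hjP' : j₀ ≤ jP := hj.trans ((min_le_right _ _).trans (min_le_left _ _))
  have hjX' : j₀ ≤ jX := hj.trans ((min_le_right _ _).trans (min_le_right _ _))
  have hc₀ : (0 : ℝ) < c₀ := Fact.out
  have hLd : (0 : ℝ) < ((L : ℝ) ^ (n + 1)) ^ d := by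
    have : (0 : ℝ) < L := by exact_mod_cast hL
    positivity
  haveI : Nonempty (Bond d (towerP L m (n + 1))) := ⟨bd⟩
  have y₀ : TSite d (towerP L m (n + 1)) := fun _ => 0
  haveI : Nonempty (Bond d m) := ⟨(v, ⟨0, hd⟩)⟩
  have hF : 0 ≤ F := (norm_nonneg _).trans (hzF (v, ⟨0, hd⟩))
  have hj₀ : 0 ≤ j₀ := (norm_nonneg _).trans (hJ ⟨0, hd⟩ y₀)
  -- names
  set piS : TSite d (towerP L m (n + 1)) → TSite d m := fun x => blockCoord (L ^ (n + 1)) m (siteCast (towerP_eq_fineP_pow L m (n + 1)) x) with hpiS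
  set piB : Bond d (towerP L m (n + 1)) → TSite d m := fun b' => piS (bpos b') with hpiB
  set piC : Bond d m → TSite d m := fun c' => c'.1 with hpiC
  set GU := G1k L m n φ η U hL αU hα1 hU1 hreg τ (c₀ := c₀) (c₁ := c₁) hpos with hGU
  set Gt := G1LatticeK hposπ with hGt
  set QU := QkW L m n φ U hL αU hα1 hU1 hreg (c₀ := c₀) (c₁ := c₁) with hQU'
  set KU := KinvLatticeK hpos hQ with hKU
  set Kp := KinvLatticeK hposπ hQ with hKp
  -- the CLMs
  obtain ⟨TGd, hTGd⟩ : ∃ T : BondL2K ℂ d (towerP L m (n + 1)) c₀ W →L[ℂ] BondL2K ℂ d (towerP L m (n + 1)) c₀ W, T = LinearMap.toContinuousLinearMap (Gt - GU) :=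
    ⟨_, rfl⟩
  obtain ⟨TGU, hTGU⟩ : ∃ T : BondL2K ℂ d (towerP L m (n + 1)) c₀ W →L[ℂ] BondL2K ℂ d (towerP L m (n + 1)) c₀ W, T = LinearMap.toContinuousLinearMap GU := ⟨_, rfl⟩
  obtain ⟨SU, hSU⟩ : ∃ T : BondL2K ℂ d m c₁ W →L[ℂ] BondL2K ℂ d (towerP L m (n + 1)) c₀ W, T = LinearMap.toContinuousLinearMap (LinearMap.adjoint QU) := ⟨_, rfl⟩
  obtain ⟨Kpcl, hKpcl⟩ : ∃ T : BondL2K ℂ d m c₁ W →L[ℂ] BondL2K ℂ d m c₁ W, T = LinearMap.toContinuousLinearMap Kp := ⟨_, rfl⟩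
  obtain ⟨KDcl, hKDcl⟩ : ∃ T : BondL2K ℂ d m c₁ W →L[ℂ] BondL2K ℂ d m c₁ W, T = LinearMap.toContinuousLinearMap (Kp - KU) := ⟨_, rfl⟩
  -- (1) the letters at the common rate `κ₀`
  have hweak : ∀ {r' : ℝ} (t : ℝ), κ₀ ≤ r' → 0 ≤ t → Real.exp (-(r' * t)) ≤ Real.exp (-(κ₀ * t)) := fun t hr ht => Real.exp_le_exp.mpr (by nlinarith)
  have hcomp : ∀ {D : ℝ}, D ≤ 1 → (1 : ℝ) ≤ Real.exp κ₀ * Real.exp (-(κ₀ * D)) := fun {D} hD => by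
    rw [← Real.exp_add]; exact Real.one_le_exp (by nlinarith [mul_le_mul_of_nonneg_left hD hκ₀0.le])
  -- (L)(G̃_k − G₁,k; j₀·CD, κ₀)
  have hLGd : ∀ (w : TSite d m) (f : BondL2K ℂ d (towerP L m (n + 1)) c₀ W) (F : ℝ), (∀ x, piB x ≠ w → WL2.equiv ℂ (fun _ : Bond d (towerP L m (n + 1)) => c₀) W f x = 0) →
      (∀ x, ‖WL2.equiv ℂ (fun _ : Bond d (towerP L m (n + 1)) => c₀) W f x‖ ≤ F) →
      ∀ b', ‖WL2.equiv ℂ (fun _ : Bond d (towerP L m (n + 1)) => c₀) W (TGd f) b'‖ ≤ (j₀ * CD) * Real.exp (-(κ₀ * tdist m (piB b') w)) * F := by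
    intro w f F hfv hfF b'
    have hF : 0 ≤ F := (norm_nonneg _).trans (hfF b')
    rw [hTGd, LinearMap.coe_toContinuousLinearMap', LinearMap.sub_apply]
    refine ((HD n η hηL c₀ c₁ hw hρ m hm U αU hα0 hα1 hU1 hreg εU hεU hUε hLb α hα hαD' hUst hUb hUη hpl hUgrad hRlev hεg hAQ hpos' hpos hc₀η j₀ hJ hjD' hposπ
      w f F hfv hfF b' y₀).1).trans ?_
    exact mul_le_mul_of_nonneg_right (mul_le_mul_of_nonneg_left (hweak _ hκ₀D (tdist_nonneg m _ _)) (mul_nonneg hj₀ hCD)) hF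
  -- (L)(G₁,k(U); BG, κ₀)
  have hLGU : ∀ (w : TSite d m) (f : BondL2K ℂ d (towerP L m (n + 1)) c₀ W) (F : ℝ), (∀ x, piB x ≠ w → WL2.equiv ℂ (fun _ : Bond d (towerP L m (n + 1)) => c₀) W f x = 0) →
      (∀ x, ‖WL2.equiv ℂ (fun _ : Bond d (towerP L m (n + 1)) => c₀) W f x‖ ≤ F) →
      ∀ b', ‖WL2.equiv ℂ (fun _ : Bond d (towerP L m (n + 1)) => c₀) W (TGU f) b'‖ ≤ BG * Real.exp (-(κ₀ * tdist m (piB b') w)) * F := by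
    intro w f F hfv hfF b'
    have hF : 0 ≤ F := (norm_nonneg _).trans (hfF b')
    rw [hTGU, LinearMap.coe_toContinuousLinearMap']
    refine (ROWU n η hηL c₀ c₁ hw hρ m hm U αU hα0 hα1 hU1 hreg εU hεU hUε hLb α hα hαG' hUst hUb hUη hpl hUgrad hRlev hεg hAQ hpos' hpos
      w f F hfv hfF b').trans ?_
    exact mul_le_mul_of_nonneg_right (mul_le_mul_of_nonneg_left (hweak _ hκ₀G (tdist_nonneg m _ _)) hBG) hF
  -- (L)(Q_k(U)†; KSU, κ₀) on coarse-bond sources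
  have hzone : ∀ (w : TSite d m) (h : BondL2K ℂ d m c₁ W) (H : ℝ), (∀ c', piC c' ≠ w → WL2.equiv ℂ (fun _ : Bond d m => c₁) W h c' = 0) →
      (∀ c', ‖WL2.equiv ℂ (fun _ : Bond d m => c₁) W h c'‖ ≤ H) → ∀ (b' : Bond d (towerP L m (n + 1))) (c' : Bond d m),
      (blockCoord (L ^ (n + 1)) m (siteCast (towerP_eq_fineP_pow L m (n + 1)) b'.1) = c'.1 ∨
        blockCoord (L ^ (n + 1)) m (siteCast (towerP_eq_fineP_pow L m (n + 1)) b'.1) = shift c'.2 c'.1) →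
      ‖WL2.equiv ℂ (fun _ : Bond d m => c₁) W h c'‖ ≤ Real.exp κ₀ * Real.exp (-(κ₀ * tdist m (piB b') w)) * H := by
    intro w h H hhv hhF b' c' hc
    have hH : 0 ≤ H := (norm_nonneg _).trans (hhF c')
    by_cases hcw : c'.1 = w
    · have hD : tdist m (piB b') w ≤ 1 := by
        show tdist m (blockCoord (L ^ (n + 1)) m (siteCast (towerP_eq_fineP_pow L m (n + 1)) b'.1)) w ≤ 1
        rcases hc with hc | hc
        · rw [hc, hcw, tdist_self]; exact zero_le_one
        · rw [hc, ← hcw, tdist_symm hm]; exact tdist_shift_le_one hm c'.1 c'.2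
      calc ‖WL2.equiv ℂ (fun _ : Bond d m => c₁) W h c'‖ ≤ 1 * H := by rw [one_mul]; exact hhF c'
        _ ≤ (Real.exp κ₀ * Real.exp (-(κ₀ * tdist m (piB b') w))) * H := mul_le_mul_of_nonneg_right (hcomp hD) hH
        _ = _ := by ring
    · rw [hhv c' hcw, norm_zero]; positivity
  have hLSU : ∀ (w : TSite d m) (h : BondL2K ℂ d m c₁ W) (H : ℝ), (∀ c', piC c' ≠ w → WL2.equiv ℂ (fun _ : Bond d m => c₁) W h c' = 0) →
      (∀ c', ‖WL2.equiv ℂ (fun _ : Bond d m => c₁) W h c'‖ ≤ H) →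
      ∀ b', ‖WL2.equiv ℂ (fun _ : Bond d (towerP L m (n + 1)) => c₀) W (SU h) b'‖ ≤ KSU * Real.exp (-(κ₀ * tdist m (piB b') w)) * H := by
    intro w h H hhv hhF b'
    have hH : 0 ≤ H := (norm_nonneg _).trans (hhF (w, ⟨0, hd⟩))
    rw [hSU, LinearMap.coe_toContinuousLinearMap']
    have hM : 0 ≤ Real.exp κ₀ * Real.exp (-(κ₀ * tdist m (piB b') w)) * H := by positivity
    have h1 := norm_adjoint_QkW_apply_le_local_sharp (c₀ := c₀) (c₁ := c₁) L m n φ U hL αU hα0 hα1 hU1 hreg hMφ hφ hMφ' hφ' hAQ h b' hM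
      (hzone w h H hhv hhF b')
    have he : c₁ / c₀ * (Mφ' * ((((L : ℝ) ^ (n + 1)) ^ d)⁻¹ * Real.exp (100 * d * (d + 1) * (L : ℝ) ^ d * AQ)) * Mφ) = Mφ' * Mφ * EA := by
      rw [hEA, ← hw]; field_simp
    rw [he] at h1
    exact h1.trans (le_of_eq (by rw [hKSU]; ring))
  -- (L)(K̃_k⁻¹; BP, κ₀) and (L)(K̃_k⁻¹ − K_k⁻¹; j₀·KX, κ₀) on the coarse bonds
  have hLKp : ∀ (w : TSite d m) (h : BondL2K ℂ d m c₁ W) (H : ℝ), (∀ c', piC c' ≠ w → WL2.equiv ℂ (fun _ : Bond d m => c₁) W h c' = 0) →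
      (∀ c', ‖WL2.equiv ℂ (fun _ : Bond d m => c₁) W h c'‖ ≤ H) →
      ∀ c', ‖WL2.equiv ℂ (fun _ : Bond d m => c₁) W (Kpcl h) c'‖ ≤ BP * Real.exp (-(κ₀ * tdist m (piC c') w)) * H := by
    intro w h H hhv hhF c'
    have hH : 0 ≤ H := (norm_nonneg _).trans (hhF c')
    rw [hKpcl, LinearMap.coe_toContinuousLinearMap']
    refine (HP n η hηL c₀ c₁ hw hρ m hm U αU hα0 hα1 hαL hU1 hreg εU hεU hUε hLb α hα hαP' hUst hUb hUη hpl hUgrad hRlev hεg hAQ hpos' hpos hc₀η j₀ hJ hjP' hposπ hQ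
      w h H hhv hhF c').trans ?_
    exact mul_le_mul_of_nonneg_right (mul_le_mul_of_nonneg_left (hweak _ hκ₀P (tdist_nonneg m _ _)) hBP) hH
  have hLKD : ∀ (w : TSite d m) (h : BondL2K ℂ d m c₁ W) (H : ℝ), (∀ c', piC c' ≠ w → WL2.equiv ℂ (fun _ : Bond d m => c₁) W h c' = 0) →
      (∀ c', ‖WL2.equiv ℂ (fun _ : Bond d m => c₁) W h c'‖ ≤ H) →
      ∀ c', ‖WL2.equiv ℂ (fun _ : Bond d m => c₁) W (KDcl h) c'‖ ≤ (j₀ * KX) * Real.exp (-(κ₀ * tdist m (piC c') w)) * H := by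
    intro w h H hhv hhF c'
    have hH : 0 ≤ H := (norm_nonneg _).trans (hhF c')
    rw [hKDcl, LinearMap.coe_toContinuousLinearMap', LinearMap.sub_apply]
    refine (HX n η hηL c₀ c₁ hw hρ m hm U αU hα0 hα1 hαL hU1 hreg εU hεU hUε hLb α hα hαX' hUst hUb hUη hpl hUgrad hRlev hεg hAQ hpos' hpos hc₀η j₀ hJ hjX' hposπ hQ
      w h H hhv hhF c').trans ?_
    exact mul_le_mul_of_nonneg_right (mul_le_mul_of_nonneg_left (hweak _ hκ₀X (tdist_nonneg m _ _)) (mul_nonneg hj₀ hKX)) hH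
  -- (2) the two words
  have hrow : ∀ w : TSite d m, ∑ u, Real.exp (-((κ₀ - κ₀ / 2) * tdist m w u)) ≤ S := fun w => by
    rw [show κ₀ - κ₀ / 2 = κ₀ / 2 by ring]; exact torusSum_le d hm (half_pos hκ₀0) w
  have hδ0 : ∀ u v : TSite d m, 0 ≤ tdist m u v := fun u v => tdist_nonneg _ _ _
  have hδt : ∀ u y v : TSite d m, tdist m u v ≤ tdist m u y + tdist m y v := fun u y v => tdist_triangle hm u y v
  have hκ'0 : (0 : ℝ) ≤ κ₀ / 2 := by positivity
  have hκ'1 : κ₀ / 2 ≤ κ₀ := by linarith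
  -- word 1: `(G̃ − G) Q† K̃⁻¹`
  have hW1a := letter_comp (𝕜 := ℂ) (tdist m) piC piC piB Kpcl SU hδ0 hδt hBP hKSU0 hκ'0 hκ'1 hLKp hLSU hrow
  have hW1 := letter_comp (𝕜 := ℂ) (tdist m) piC piB piB (SU ∘L Kpcl) TGd hδ0 hδt (by positivity) (mul_nonneg hj₀ hCD) hκ'0 le_rfl hW1a hLGd hrow
  -- word 2: `G Q† (K̃⁻¹ − K⁻¹)`
  have hW2a := letter_comp (𝕜 := ℂ) (tdist m) piC piC piB KDcl SU hδ0 hδt (mul_nonneg hj₀ hKX) hKSU0 hκ'0 hκ'1 hLKD hLSU hrow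
  have hW2 := letter_comp (𝕜 := ℂ) (tdist m) piC piB piB (SU ∘L KDcl) TGU hδ0 hδt (by positivity) hBG hκ'0 le_rfl hW2a hLGU hrow
  -- (3) the telescoping identity `H̃ − H = (G̃ − G)Q†K̃⁻¹ + GQ†(K̃⁻¹ − K⁻¹)`
  have eP : H1LatticeK hposπ hQ z = Gt (LinearMap.adjoint QU (Kp z)) := rfl
  have eU : H1LatticeK hpos hQ z = GU (LinearMap.adjoint QU (KU z)) := rfl
  have hsplit : Gt (LinearMap.adjoint QU (Kp z)) - GU (LinearMap.adjoint QU (KU z)) = ((TGd ∘L (SU ∘L Kpcl)) + (TGU ∘L (SU ∘L KDcl))) z := by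
    simp only [add_apply, ContinuousLinearMap.coe_comp, Function.comp_apply]
    rw [hTGd, hTGU, hSU, hKpcl, hKDcl]
    simp only [LinearMap.coe_toContinuousLinearMap']
    simp only [LinearMap.sub_apply, map_sub]
    abel
  rw [eP, eU, hsplit]
  have h12 := letter_add (𝕜 := ℂ) (tdist m) piC piB _ _ hW1 hW2 v z F hzv hzF bd
  refine h12.trans (le_of_eq ?_)
  simp only [hK, hpiB, hpiS]
  ring

end Literature.MathematicalPhysics.QuantumFieldTheory.Balaban1983to89.B9Eq3133H1kPiSubH1kLetterTower

end
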